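import Summits.QuantumFields.YangMills.Theorems.LuscherReductionDressedRitzLiftLeakageBasisGeneric
import Summits.QuantumFields.YangMills.Theorems.LuscherReductionDressedRitzPolyakovLiftTransplant
import Literature.Analysis.OperatorTheory.YangMillsMatrixModelGroundStateSign
import HarnessLib

/-!
# Crux `DressedRitz` (stmt-QuantumFields-20205), line «polyakovlift», stub S-LEAK — support XXIII:
# the r6 text `∀ k, LeakageFor (TransplantBasis k)` — non-vacuity of its basis quantifier, its named cores, the trivial level

Support module (fleet seat ym-20205-polyakovlift-s1 gen 2; `--supports stmt-QuantumFields-20205`, helper, no closure claim).  The lead's candidate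
skeleton r6 («explicit transplanted observables») reads S-LEAK as `Stmt.stub_liftLeakage := ∀ k, LeakageFor (TransplantBasis k)` (texts p551613, basis
predicate p551813).  Support XXII (`…LiftLeakageBasisGeneric.lean`, p555044) gave the closing package for an arbitrary physical basis predicate; this file
instantiates it at the transplant predicate and records the vacuity audit of the new quantifier domain:

* §1 ★ `exists_transplantBasis` — for `0 < Λ ≤ 1/4` the predicate `TransplantBasis k Λ` is INHABITED (witness: an AL1 eigenfamily with positive ground
  state, Literature `exists_eigenfunctions_pos_groundState`, PROVED; cut-off radius `R = 1/(4Λ)`, the femto-scale radius of the lead's S-PSCAL″ plan and of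
  both repairs (a)/(b) of the disprover's pre-vet V1); `exists_transplantBasis_window` — hence in the femto window at every `lam ≤ 1/8` the `∀ g,
  TransplantBasis k (λ(β,L)) g → …` quantifier of S-STAT″/S-UNIV″/S-LEAK″ is NOT vacuous;
* §2 `leakageFor_zero` — at `k = 0` (no excited channel) `LeakageFor P` holds for every predicate (`C = 0`); the r6 S-LEAK text has content from `k = 1`;
* §3 BY NAME for the r6 text: ★★★ `transplantLeakage_of_firstMomentCoreFor : (∀ k, FirstMomentCoreFor (TransplantBasis k)) → ∀ k, LeakageFor (TransplantBasis k)`,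
  `transplantLeakage_of_slowOutsideCoreFor`, `transplantLeakage_iff_euclidean`, and `transplantLeakage_of_imp` (any sub-predicate, e.g. a pinned radius,
  inherits the text).

So the r6 crux-map row reads «S-LEAK″ ⟸ `transplantLeakage_of_firstMomentCoreFor` ⟸ ■ `FirstMomentCoreFor (TransplantBasis k)` (∀ k)»: per transplanted
observable `g_i = (χ_R f_{i+1}/f_0)∘expCoord(Λ/2)` and lattice point, on the undressed flowed-Polyakov insertion state `x_i = liftVec β Ω g_i`, the first-moment
band admixture budget (NEAR₁) `O(λ²/L)`, the band width (BAND) `O(λ/L)λ₀` and the `L`-uniform out-of-band weight (OUT) `O(λ³)` — OPEN renormalisation-group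
estimates, unchanged in physics from r5.

HONEST FRAMING: vacuity audit + quantifier plumbing at fixed lattice on the conditional femto rung R2b1; the r6 S-LEAK text stays OPEN; nothing here bears on
infinite volume, the continuum limit or the Clay gap.
References: M. Lüscher, NPB 219 (1983) 233 [cite: Luscher1983, §2–§3]; M. Lüscher, U. Wolff, NPB 339 (1990) 222 [cite: LuscherWolff1990, §2];
M. Reed, B. Simon IV (1978) Thm XIII.47–48, XIII.64 [cite: ReedSimonIV1978].
-/

set_option autoImplicit false

noncomputable section

open MeasureTheory Filter Topology Finset
open Literature.MathematicalPhysics.QuantumFieldTheory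
open Literature.MathematicalPhysics.QuantumLattice
open Literature.Analysis.OperatorTheory.YMMatrixModel
open scoped BigOperators

namespace Summit.QuantumFields.YangMills.Theorems.FemtoTransferGap.LiftLeak

open Summit.QuantumFields.YangMills.Theorems.FemtoTransferGap
open Summit.QuantumFields.YangMills.Theorems.FemtoTransferGap.PolyakovLift
open Summit.QuantumFields.YangMills.Theorems.FemtoTransferGap.VacDict

/-! ## §1 The transplant predicate is inhabited for `0 < Λ ≤ 1/4` -/

/-- ★ **`TransplantBasis k Λ` is inhabited for `0 < Λ ≤ 1/4`**: take an AL1 eigenfamily `f_0, …, f_k` of Lüscher's matrix Hamiltonian with `f_0 > 0`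
(Literature `exists_eigenfunctions_pos_groundState`, proved) and the femto-scale cut-off radius `R = 1/(4Λ)` (`1 ≤ R`, `RΛ = 1/4`).
[cite: ReedSimonIV1978, Thm. XIII.47–48, Thm. XIII.64] [cite: Luscher1983, §2–§3] -/
theorem exists_transplantBasis (k : ℕ) {Λ : ℝ} (hΛ : 0 < Λ) (hΛ4 : Λ ≤ 1 / 4) :
    ∃ g : Fin k → (GaugeConfig 3 1 SU2 → ℝ), TransplantBasis k Λ g := by
  obtain ⟨f, hsmooth, hinv, horth, heig, hdec, hpos⟩ := exists_eigenfunctions_pos_groundState k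
  refine ⟨fun i => transplantObs Λ (1 / (4 * Λ)) f i, f, 1 / (4 * Λ), ⟨hsmooth, hinv, horth, heig, hdec⟩, hpos, ?_, ?_, fun _ => rfl⟩
  · rw [le_div_iff₀ (by positivity)]
    linarith
  · rw [div_mul_eq_mul_div, one_mul, div_le_iff₀ (by positivity)]
    linarith

/-- **In the femto window the basis quantifier of the r6 stubs is not vacuous**: for `0 < lam ≤ 1/8` and `InFemtoWindow lam β L`
(`λ(β,L) ∈ [lam, 2lam] ⊆ (0, 1/4]`) there is a transplant basis at `Λ = λ(β,L)`. [cite: Luscher1983, §2–§3] -/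
theorem exists_transplantBasis_window (k : ℕ) {lam β : ℝ} {L : ℕ} (hlam : 0 < lam) (hlam8 : lam ≤ 1 / 8) (hW : InFemtoWindow lam β L) :
    ∃ g : Fin k → (GaugeConfig 3 1 SU2 → ℝ), TransplantBasis k (luscherLambda β L) g :=
  exists_transplantBasis k (hlam.trans_le hW.2.1) (hW.2.2.trans (by linarith))

/-! ## §2 The trivial level `k = 0` -/

/-- At `k = 0` (no excited channel) `LeakageFor P` holds for every basis predicate, with `C = 0` (the clause quantifies over `Fin 0`). [folklore] -/
theorem leakageFor_zero (P : ℝ → (Fin 0 → (GaugeConfig 3 1 SU2 → ℝ)) → Prop) : LeakageFor P :=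
  ⟨0, 1, le_rfl, one_pos, fun _ _ _ => ⟨0, fun _ _ _ _ _ _ _ _ _ i => i.elim0⟩⟩

/-- Likewise the per-member cores are trivially available at `k = 0`. [folklore] -/
theorem firstMomentCoreFor_zero (P : ℝ → (Fin 0 → (GaugeConfig 3 1 SU2 → ℝ)) → Prop) : FirstMomentCoreFor P :=
  ⟨0, 1, le_rfl, one_pos, fun _ _ _ => ⟨0, fun _ _ _ _ _ _ _ _ _ _ _ _ _ i => i.elim0⟩⟩

/-! ## §3 The r6 S-LEAK text by name -/

/-- ★★★ **`(∀ k, FirstMomentCoreFor (TransplantBasis k)) → ∀ k, LeakageFor (TransplantBasis k)`** — the r6 S-LEAK text from the per-member first-moment core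
(XXII at the transplant predicate; members physical by `basisPhys_transplantBasis`). [cite: Luscher1983, §3] [cite: LuscherWolff1990, §2] -/
theorem transplantLeakage_of_firstMomentCoreFor (h : ∀ k : ℕ, FirstMomentCoreFor (TransplantBasis k)) :
    ∀ k : ℕ, LeakageFor (TransplantBasis k) :=
  fun k => leakageFor_of_firstMomentCoreFor (basisPhys_transplantBasis k) (h k)

/-- ★★ **`(∀ k, SlowOutsideCoreFor (TransplantBasis k)) → ∀ k, LeakageFor (TransplantBasis k)`** (second-moment form of the core).
[cite: Luscher1983, §3] [cite: LuscherWolff1990, §2] -/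
theorem transplantLeakage_of_slowOutsideCoreFor (h : ∀ k : ℕ, SlowOutsideCoreFor (TransplantBasis k)) :
    ∀ k : ℕ, LeakageFor (TransplantBasis k) :=
  fun k => leakageFor_of_slowOutsideCoreFor (basisPhys_transplantBasis k) (h k)

/-- ★ **The r6 S-LEAK text in Euclidean currency**: `(∀ k, LeakageFor (TransplantBasis k)) ↔ ∀ k, EuclideanLeakageFor (TransplantBasis k)` — (E4), the
log-convexity defect of the normalised connected autocorrelation of the transplanted flowed-Polyakov insertion at separation `2L+1` is `≤ C(λ³/L²)` relative.
[cite: LuscherWolff1990, §2] -/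
theorem transplantLeakage_iff_euclidean :
    (∀ k : ℕ, LeakageFor (TransplantBasis k)) ↔ ∀ k : ℕ, EuclideanLeakageFor (TransplantBasis k) :=
  forall_congr' fun k => leakageFor_iff_euclideanFor (basisPhys_transplantBasis k)

/-- **Sub-predicates inherit the text**: if every `Q k`-basis is a transplant basis (e.g. `Q` = transplant bases with a PINNED cut-off radius, the disprover's
pre-vet V1 repair), then the r6 S-LEAK text for `TransplantBasis` gives it for `Q`, same constants. [folklore] -/
theorem transplantLeakage_of_imp {Q : (k : ℕ) → ℝ → (Fin k → (GaugeConfig 3 1 SU2 → ℝ)) → Prop}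
    (hQ : ∀ k Λ g, Q k Λ g → TransplantBasis k Λ g) (h : ∀ k : ℕ, LeakageFor (TransplantBasis k)) : ∀ k : ℕ, LeakageFor (Q k) :=
  fun k => leakageFor_of_imp (hQ k) (h k)

end Summit.QuantumFields.YangMills.Theorems.FemtoTransferGap.LiftLeak

end
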